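import Literature.MathematicalPhysics.QuantumFieldTheory.Balaban1983to89.B14Eq356FieldStrength
import Literature.MathematicalPhysics.QuantumFieldTheory.Balaban1983to89.B14Eq360TensorInvariance
import Literature.MathematicalPhysics.QuantumFieldTheory.Balaban1983to89.B14Eq362Marginals

/-!
# `Balaban1983to89.B14.Eq361Scalar` — T. Bałaban, *Convergent renormalization expansions for lattice gauge theories*,
# Commun. Math. Phys. **119** (1988) 243–285 [Balaban1988Convergent]: (3.61) AS PRINTED — *"Thus we obtain (3.57) =
# β′_j ½ Σ_{μ<ν} tr F²_{μν}(z), β′_j = Π^{(j)}_{22,11}"* — the SCALAR form of the resummed second-order term, PROVED from the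
# invariance structure (3.60); and the p. 283 cancellation against (3.66) giving the (3.67)-shaped per-point bound

statement-level skeleton of published theorems with citation tags; proofs where landed; nothing here is a claim about the Yang–Mills mass gap

PDF held: `paper:balaban1988-cmp119-convergent-renormalization` (journal page = PDF page + 242); pp. 281–283 [PDF 39–41] read from
the OCR text layer and the x2 renders `…-p039-x2.png`, `…-p040-x2.png`, `…-p041-x2.png` of the cell `pub-balaban` ((3.61) as transcribed in
`B14Sect3.invariant_tensor_361` and `B14.Eq364Beta`, whose authors read the same renders).

CITATION HEADER (lean-in-tree rule).  WHAT IS REPRODUCED, verbatim.  [Balaban1988Convergent] p. 281: *"Thus we obtain the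
identity (3.56) resummed over the domains X, but with the first expression on the right-hand side replaced by ½ Σ_{κ<μ,λ<ν}
Π^{(j)}_{μν,κλ} tr F_{κμ}(z)F_{λν}(z). (3.57)"*; p. 282: *"This invariance has the usual implications … Considering reflections
we conclude that in this case the coefficients in the sum are different from 0 only if μ = ν and κ = λ. Considering
permutations we conclude that then they are all equal, e.g. they are equal to their values for μ = ν = 2, κ = λ = 1. Thus we
obtain (3.57) = β′_j ½ Σ_{μ<ν} tr F²_{μν}(z), β′_j = Π^{(j)}_{22,11}. (3.61)"*; p. 283: *"A(h_z, U_k) = ½ Σ_{μ<ν} tr F²_{μν}(z)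
+ (the irrelevant terms). (3.66) Thus the first expression on the right-hand side of the expansion of −β_jA(h_z, U_k)
cancels the expression on the right-hand side of (3.61), and we are left with the irrelevant terms only. … we have the
following conclusion: 𝐄^{(j)}(Λ_j, U_k, z) − 𝐄^{(j)}(Λ_j, 1, z) − β_jA(h_z, U_k) = O((LʲL⁻ⁿ)^{5−β}), (3.67)"*; p. 281: *"(the
irrelevant terms) above, and in (3.49), denotes the sum of terms which can be bounded by O((LʲL⁻ⁿ)^{5−β}) exp(−κd_j(X)),
where β is a positive number."*

SKELETON rows (owner r11): **B14.Eq3.58–3.61** — (3.61) so far: the NUMBER `β′_j` (`B14.Eq364Beta.betaPrime`) and the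
δδ-structure of the coefficient table on `κ < μ, λ < ν` (`B14Sect3.invariant_tensor_361`; with (3.59)/(3.60) discharged on the
infinite lattice: `B14.Eq360TensorInvariance.eq361_of_covariance`); the DISPLAYED EQUALITY "(3.57) = β′_j ½Σ_{μ<ν} tr F²_{μν}(z)"
was not typed.  **B14.Eq3.55–3.57** ((3.57) = `B14.Eq356FieldStrength.expr357`), **B14.Eq3.65–3.66** (the cancellation
sentence; `B14.Eq366ActionF2.cancels_361` is the bare arithmetic `β′Q + (−βQ) = 0`), **B14.Eq3.67** (the per-point bound
consumed by `B14Sect3.Rep367`/`ineq243_of_rep367`).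

WHAT IS PROVED.  §1 `expr356_of_diag`: for ANY coefficient table which, on the printed index range `κ < μ, τ < ν`, equals
`c·δ_{μν}δ_{κτ}`, the sum (3.57) `Σ_{κ<μ,τ<ν} ½ E_{μν,κτ} Re tr F_{κμ}(z)F_{τν}(z)` (`expr356`/`expr357`) EQUALS
`c · ½ Σ_{μ<ν} Re tr F²_{μν}(z)` (`halfTrFSq`) — (3.61) as printed, any dimension; §2 `eq361_printed`: the same from the
invariances (3.60) in the abstract form of `B14Sect3.invariant_tensor_361` (reflections + permutations), `c = Π_{μ₀μ₀,κ₀κ₀}`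
for any `κ₀ ≠ μ₀`; §3 `eq361_lattice`/`eq361_lattice_of_WT`: the same ON THE INFINITE LATTICE for the moment tensor
`B14.Eq360TensorInvariance.P4 Π` of a decaying three-point kernel with the covariances (3.59), `c = β′_j = betaPrime Π one two`,
the marginal identities taken as hypotheses resp. DISCHARGED to (I.4.15)₁ in kernel form (`B14.Eq362Marginals`); §4
`eq367_pointwise`: the p. 283 algebra — if the 𝐄-difference is `β′_j·Q + I₁` ((3.49)–(3.61), `Q = ½Σ_{μ<ν} tr F²_{μν}(z)`),
`A(h_z, U_k) = Q + I₂` ((3.66)) and `β′_j = β_j` ((3.64)), then `𝐄 − 𝐄(1) − β_jA(h_z) = I₁ − β_jI₂`, so irrelevant-term bounds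
`|I₁| ≤ c₁s^{5−β}`, `|I₂| ≤ c₂s^{5−β}` (`s = LʲL⁻ⁿ`) give `|…| ≤ (c₁ + |β_j|c₂)s^{5−β}` — the per-point input `|t z| ≤ c(L^{j−n})^{5−β′}`
of `B14Sect3.Rep367`.  NOT HERE: that (3.49)/(3.57)/(3.66) HOLD for Bałaban's functions with the printed irrelevant-term
bounds (the analytic content of pp. 279–283 and of Sect. 4 [I]).  Theorems and two transparent abbreviations-as-theorems
only; no `sorry`.

Mega-formalization `lit-balaban`, unit `lit-balaban-r11` gen 5 (B14 fold owner), HOME `run/shared/lean/pub/lit-balaban/`.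

## References
* [Balaban1988Convergent] T. Bałaban, Commun. Math. Phys. 119 (1988) 243–285, (3.57) p.281, (3.60)–(3.61) p.282,
  (3.64)–(3.67) p.283.
-/

namespace Literature.MathematicalPhysics.QuantumFieldTheory.Balaban1983to89.B14.Eq361Scalar

open Finset Matrix
open Literature.MathematicalPhysics.QuantumFieldTheory.GawedzkiKupiainen1985.PeriodicGleason
open Literature.MathematicalPhysics.QuantumFieldTheory.Balaban1983to89
open Literature.MathematicalPhysics.QuantumFieldTheory.Balaban1983to89.B14.Eq356FieldStrength
open Literature.MathematicalPhysics.QuantumFieldTheory.Balaban1983to89.B14.Eq364Beta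
open Literature.MathematicalPhysics.QuantumFieldTheory.Balaban1983to89.B14.Eq360TensorInvariance

variable {d : ℕ} {n : Type*} [Fintype n]

/-! ## §1. (3.61) as printed from the δδ-structure of the coefficients on `κ < μ, τ < ν` -/

/-- **(3.61) as printed, abstract coefficient table**: if on the index range `κ < μ`, `τ < ν` of the sum (3.57) the table is
`E_{μν,κτ} = c·δ_{μν}δ_{κτ}` (*"different from 0 only if μ = ν and κ = λ … then they are all equal"*), then
`Σ_{κ<μ,τ<ν} ½E_{μν,κτ} Re tr F_{κμ}(z)F_{τν}(z) = c · ½Σ_{μ<ν} Re tr F²_{μν}(z)` — *"(3.57) = β′_j ½Σ_{μ<ν} tr F²_{μν}(z)"*.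
[cite: Balaban1988Convergent, (3.61) p.282] -/
theorem expr356_of_diag (E : Fin d → Fin d → Fin d → Fin d → ℝ) (c : ℝ)
    (hE : ∀ μ ν κ τ, κ < μ → τ < ν → E μ ν κ τ = if (μ = ν ∧ κ = τ) then c else 0)
    (dB : Fin d → Fin d → Matrix n n ℂ) (B : Fin d → Matrix n n ℂ) :
    expr356 E dB B = c * ∑ μ, ∑ ν, (if μ < ν then
      (1/2 : ℝ) * ((fieldStrength dB B μ ν * fieldStrength dB B μ ν).trace).re else 0) := by
  unfold expr356
  -- for fixed `μ, κ` with `κ < μ` only `(ν, τ) = (μ, κ)` survives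
  have hinner : ∀ μ κ, κ < μ →
      ∑ ν, ∑ τ, (if τ < ν then E μ ν κ τ *
        ((1/2 : ℝ) * ((fieldStrength dB B κ μ * fieldStrength dB B τ ν).trace).re) else 0)
      = c * ((1/2 : ℝ) * ((fieldStrength dB B κ μ * fieldStrength dB B κ μ).trace).re) := by
    intro μ κ hκμ
    rw [Finset.sum_eq_single μ]
    · rw [Finset.sum_eq_single κ]
      · rw [if_pos hκμ, hE μ μ κ κ hκμ hκμ, if_pos ⟨rfl, rfl⟩]
      · intro τ _ hτ
        by_cases h : τ < μ
        · rw [if_pos h, hE μ μ κ τ hκμ h, if_neg (fun h2 => hτ h2.2.symm), zero_mul]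
        · rw [if_neg h]
      · intro h; exact absurd (Finset.mem_univ κ) h
    · intro ν _ hν
      refine Finset.sum_eq_zero fun τ _ => ?_
      by_cases h : τ < ν
      · rw [if_pos h, hE μ ν κ τ hκμ h, if_neg (fun h2 => hν h2.1.symm), zero_mul]
      · rw [if_neg h]
    · intro h; exact absurd (Finset.mem_univ μ) h
  have hstep : ∑ μ, ∑ κ, ∑ ν, ∑ τ, (if κ < μ then (if τ < ν then E μ ν κ τ *
        ((1/2 : ℝ) * ((fieldStrength dB B κ μ * fieldStrength dB B τ ν).trace).re) else 0) else 0)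
      = ∑ μ, ∑ κ, (if κ < μ then
        c * ((1/2 : ℝ) * ((fieldStrength dB B κ μ * fieldStrength dB B κ μ).trace).re) else 0) := by
    refine Finset.sum_congr rfl fun μ _ => Finset.sum_congr rfl fun κ _ => ?_
    by_cases hκμ : κ < μ
    · rw [if_pos hκμ, ← hinner μ κ hκμ]
      refine Finset.sum_congr rfl fun ν _ => Finset.sum_congr rfl fun τ _ => ?_
      rw [if_pos hκμ]
    · rw [if_neg hκμ]
      exact Finset.sum_eq_zero fun ν _ => Finset.sum_eq_zero fun τ _ => by rw [if_neg hκμ]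
  rw [hstep, Finset.sum_comm, Finset.mul_sum]
  refine Finset.sum_congr rfl fun κ _ => ?_
  rw [Finset.mul_sum]
  refine Finset.sum_congr rfl fun μ _ => ?_
  split_ifs <;> ring

/-- **(3.61) as printed for (3.57)** (`expr357` = (3.56)'s right-hand side read with the resummed coefficients): same statement
for `B14.Eq356FieldStrength.expr357`. [cite: Balaban1988Convergent, (3.57) p.281, (3.61) p.282] -/
theorem expr357_of_diag (P : Fin d → Fin d → Fin d → Fin d → ℝ) (c : ℝ)
    (hP : ∀ μ ν κ τ, κ < μ → τ < ν → P μ ν κ τ = if (μ = ν ∧ κ = τ) then c else 0)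
    (dB : Fin d → Fin d → Matrix n n ℂ) (B : Fin d → Matrix n n ℂ) :
    expr357 P dB B = c * ∑ μ, ∑ ν, (if μ < ν then
      (1/2 : ℝ) * ((fieldStrength dB B μ ν * fieldStrength dB B μ ν).trace).re else 0) := by
  rw [expr357_eq]
  exact expr356_of_diag P c hP dB B

/-! ## §2. (3.60) ⇒ (3.61) as printed, from the invariances in the abstract form of `B14Sect3.invariant_tensor_361` -/

/-- **(3.60) ⇒ (3.61) as printed**: a coefficient table invariant under the axis reflections and the coordinate
permutations (*"This invariance has the usual implications"*) gives `(3.57) = Π_{μ₀μ₀,κ₀κ₀} · ½Σ_{μ<ν} Re tr F²_{μν}(z)` for any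
fixed pair `κ₀ ≠ μ₀` (print: `β′_j = Π_{22,11}`). [cite: Balaban1988Convergent, (3.60)–(3.61) p.282] -/
theorem eq361_printed (P : Fin d → Fin d → Fin d → Fin d → ℝ)
    (hrefl : ∀ α μ ν κ τ, P μ ν κ τ =
      B14Sect3.axisSign α μ * B14Sect3.axisSign α ν * B14Sect3.axisSign α κ * B14Sect3.axisSign α τ * P μ ν κ τ)
    (hperm : ∀ σ : Equiv.Perm (Fin d), ∀ μ ν κ τ, P (σ μ) (σ ν) (σ κ) (σ τ) = P μ ν κ τ)
    {μ₀ κ₀ : Fin d} (h₀ : κ₀ ≠ μ₀) (dB : Fin d → Fin d → Matrix n n ℂ) (B : Fin d → Matrix n n ℂ) :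
    expr357 P dB B = P μ₀ μ₀ κ₀ κ₀ * ∑ μ, ∑ ν, (if μ < ν then
      (1/2 : ℝ) * ((fieldStrength dB B μ ν * fieldStrength dB B μ ν).trace).re else 0) :=
  expr357_of_diag P _ (B14Sect3.invariant_tensor_361 P hrefl hperm h₀) dB B

/-! ## §3. (3.61) as printed on the infinite lattice: the moment tensor of a decaying covariant three-point kernel -/

section Lattice

variable {P3 : Fin d → Fin d → Pt d → Pt d → Pt d → ℝ} {C κ : ℝ}

/-- **(3.61) as printed, infinite lattice**: for the moment tensor `Π_{μν,κλ} = Σ_{x,y} Π_{μν}(x, y, 0)x_κy_λ`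
(`B14.Eq360TensorInvariance.P4`) of a three-point kernel with the decay (3.48), the marginal identities and the hyperoctahedral
covariances (3.59): `(3.57) = β′_j · ½Σ_{μ<ν} Re tr F²_{μν}(z)` with `β′_j = betaPrime Π one two` for ANY pair of axes
`one < two` (`B14.Eq360TensorInvariance.eq361_of_covariance` + §1). [cite: Balaban1988Convergent, (3.61) p.282] -/
theorem eq361_lattice (hD : Decay3 P3 C κ) (hκ : 0 < κ)
    (hWx : ∀ μ ν y, ∑' x, P3 μ ν x y 0 = 0) (hWy : ∀ μ ν x, ∑' y, P3 μ ν x y 0 = 0)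
    (hR : ∀ α μ ν x y, P3 μ ν x y 0 =
      B14Sect3.axisSign α μ * B14Sect3.axisSign α ν * P3 μ ν (reflSrc α μ x) (reflSrc α ν y) 0)
    (hP : ∀ (σ : Equiv.Perm (Fin d)) μ ν x y, P3 μ ν x y 0 = P3 (σ μ) (σ ν) (permPt σ x) (permPt σ y) 0)
    {one two : Fin d} (h12 : one < two) (dB : Fin d → Fin d → Matrix n n ℂ) (B : Fin d → Matrix n n ℂ) :
    expr357 (P4 P3) dB B = betaPrime P3 one two * ∑ μ, ∑ ν, (if μ < ν then
      (1/2 : ℝ) * ((fieldStrength dB B μ ν * fieldStrength dB B μ ν).trace).re else 0) := by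
  rw [betaPrime_eq_P4]
  exact expr357_of_diag (P4 P3) _ (eq361_of_covariance hD hκ hWx hWy hR hP (μ₀ := two) (κ₀ := one) h12.ne) dB B

/-- **(3.61) as printed, infinite lattice, marginals from (I.4.15)₁**: as `eq361_lattice`, with the two marginal identities
DISCHARGED to the first Ward–Takahashi identity (I.4.15)₁ in kernel form for gauge functions of finite support
(`B14.Eq362Marginals.marginal_x_eq_zero`/`marginal_y_eq_zero`). [cite: Balaban1988Convergent, (3.61) p.282] -/
theorem eq361_lattice_of_WT (hD : Decay3 P3 C κ) (hκ : 0 < κ)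
    (hWT : ∀ (μ : Fin d) (x : Pt d) (lam : Pt d → ℝ), (Function.support lam).Finite →
      ∑' y : Pt d, ∑ ν, P3 μ ν x y 0 * Eq362Marginals.grad lam ν y = 0)
    (hWT' : ∀ (ν : Fin d) (y : Pt d) (lam : Pt d → ℝ), (Function.support lam).Finite →
      ∑' x : Pt d, ∑ μ, P3 μ ν x y 0 * Eq362Marginals.grad lam μ x = 0)
    (hR : ∀ α μ ν x y, P3 μ ν x y 0 =
      B14Sect3.axisSign α μ * B14Sect3.axisSign α ν * P3 μ ν (reflSrc α μ x) (reflSrc α ν y) 0)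
    (hP : ∀ (σ : Equiv.Perm (Fin d)) μ ν x y, P3 μ ν x y 0 = P3 (σ μ) (σ ν) (permPt σ x) (permPt σ y) 0)
    {one two : Fin d} (h12 : one < two) (dB : Fin d → Fin d → Matrix n n ℂ) (B : Fin d → Matrix n n ℂ) :
    expr357 (P4 P3) dB B = betaPrime P3 one two * ∑ μ, ∑ ν, (if μ < ν then
      (1/2 : ℝ) * ((fieldStrength dB B μ ν * fieldStrength dB B μ ν).trace).re else 0) :=
  eq361_lattice hD hκ (fun μ ν y => Eq362Marginals.marginal_x_eq_zero hD hκ hWT' μ ν y)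
    (fun μ ν x => Eq362Marginals.marginal_y_eq_zero hD hκ hWT μ ν x) hR hP h12 dB B

end Lattice

/-! ## §4. p. 283: the cancellation against (3.66) and the (3.67)-shaped per-point bound -/

/-- **The cancellation, p. 283**: if the 𝐄-difference at the point `z` is `β′·Q + I₁` ((3.49)–(3.57)–(3.61), `Q = ½Σ_{μ<ν}
tr F²_{μν}(z)`, `I₁` the irrelevant terms) and `A(h_z, U_k) = Q + I₂` ((3.66)), and `β′_j = β_j` ((3.64)), then
`𝐄 − 𝐄(1) − β_jA(h_z, U_k) = I₁ − β_jI₂` — *"we are left with the irrelevant terms only"*.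
[cite: Balaban1988Convergent, (3.64)–(3.67) p.283] -/
theorem eq367_identity {Ediff A Q I₁ I₂ β β' : ℝ} (h361 : Ediff = β' * Q + I₁) (h366 : A = Q + I₂) (h364 : β' = β) :
    Ediff - β * A = I₁ - β * I₂ := by
  rw [h361, h366, h364]; ring

/-- **(3.67) shape, per point**: under the same identities and the irrelevant-term bounds `|I₁| ≤ c₁s^{5−b}`, `|I₂| ≤ c₂s^{5−b}`
(`s = LʲL⁻ⁿ`, `b > 0` the printed β): `|𝐄 − 𝐄(1) − β_jA(h_z, U_k)| ≤ (c₁ + |β_j|c₂)·s^{5−b}` — the per-point input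
`|t z| ≤ c(L^{j−n})^{5−β′}` of `B14Sect3.Rep367` (whose summation to (2.43) is `B14Sect3.ineq243_of_rep367`).
[cite: Balaban1988Convergent, (3.67) p.283] -/
theorem eq367_pointwise {Ediff A Q I₁ I₂ β β' c₁ c₂ s b : ℝ} (h361 : Ediff = β' * Q + I₁) (h366 : A = Q + I₂)
    (h364 : β' = β) (hs : 0 ≤ s) (hI₁ : |I₁| ≤ c₁ * s ^ (5 - b)) (hI₂ : |I₂| ≤ c₂ * s ^ (5 - b)) :
    |Ediff - β * A| ≤ (c₁ + |β| * c₂) * s ^ (5 - b) := by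
  rw [eq367_identity h361 h366 h364]
  have hsb : 0 ≤ s ^ (5 - b) := Real.rpow_nonneg hs _
  calc |I₁ - β * I₂| ≤ |I₁| + |β * I₂| := abs_sub _ _
    _ = |I₁| + |β| * |I₂| := by rw [abs_mul]
    _ ≤ c₁ * s ^ (5 - b) + |β| * (c₂ * s ^ (5 - b)) :=
        add_le_add hI₁ (mul_le_mul_of_nonneg_left hI₂ (abs_nonneg β))
    _ = (c₁ + |β| * c₂) * s ^ (5 - b) := by ring

end Literature.MathematicalPhysics.QuantumFieldTheory.Balaban1983to89.B14.Eq361Scalar
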